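import Mathlib
import Literature.NumberTheory.LFunctions.Zhang2022.TypedSection15C
import HarnessLib

/-!
# Zhang (2022) §15 pp. 87–88: the Euler-product merge behind u056 — `e_M·e_U = ∏_{(q,D)=1}(1 − q⁻²)`
# — and the exact main term `L′(1,χ)²(φ(D)/D)²e_Me_U = 𝔞φ(D)/D`

Topic `Literature/NumberTheory/LFunctions/Zhang2022` (Landau–Siegel audit tree; verdict-neutral).
Y. Zhang, *Discrete mean estimates and the Landau–Siegel zero*, arXiv:2211.02515v1 (2022)
[Zhang2022LandauSiegel] — an unrefereed manuscript under adjudication (cell siegel-zhang, D-0069,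
discharge lane, node `Skeleton.Ded1524`). §15 p. 88 (tex L4363–L4369): "This [u055] together with
Lemma 15.2 [`𝓜₁(1,1;s) = ∏_{(q,D)=1}(1−χ(q)q⁻²)/(1−q⁻²) + O(α₁)` =: `e_M + O(α₁)`] and 15.3 [`𝒰(1)
= φ(D)²D⁻²∏_{(q,D)=1}(1−q⁻²)²/(1−χ(q)q⁻²) + O(α₁)` =: `φ²D⁻²e_U + O(α₁)`] yields `𝓜₁(1,1;1−βⱼ)
Σ_{n∈𝒩(𝒬),n<T}χ(n)τ₂(n)ϖ₁ⱼ(n)/n = 𝔞φ(D)/D + O(1/𝓛³)` [u056], since `φ(D)D⁻¹∏_{(q,D)=1}(1−q⁻²) =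
(6/π²)∏_{q∣D}q/(q+1)` [u057]." The silent step is the MERGE of the two Euler products (typed as
`tprod`s over the primes: `Typed.Section15C.eulerM1`, `eulerU1`); this file kernel-checks it:

* `multipliable_eulerM1_eulerU1` — both coprime-restricted products CONVERGE (factors `1 + O(q⁻²)`,
  `Complex.multipliable_one_add_of_summable`), so their `tprod`s are genuine values;
* `eulerM1_mul_eulerU1` — `e_M·e_U = ∏_{(q,D)=1}(1 − q⁻²)` (`Multipliable.tprod_mul`; the factors
  multiply to `1 − q⁻²`); `eulerM1_mul_eulerU1_eq` — `= (6/π²)∏_{q∣D}(1 − q⁻²)⁻¹`, by L4-t3's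
  kernel `Typed.Section15C.tprod_coprime_one_sub_inv_sq` (the real product, cast);
* `mainTerm_u056` — **the main term of u056 is exact**: `L′(1,χ)²·(φ(D)²/D²)·(e_Me_U) = 𝔞φ(D)/D`
  for `χ` quadratic primitive, `D ≥ 3` (u057 = `step15_u057_holds`; `𝔞 = (6/π²)L′(1,χ)²∏_{q∣D}
  q/(q+1)` (2.31) with `L′(1,χ) ∈ ℝ`, tree `Lemma171.frakAC_eq`);
* `u056_pointwise` — the bookkeeping of the sentence with abstract error sizes: `‖𝓜₁·(S_T − S_N) −
  𝔞φ/D‖ ≤ C₆ε₅ + C₆ε₄ + L_b²(C₆ε₃ + ε₁(C₂ + ε₃))` (`S_T = Σ_{n<T}`, `S_N = Σ_{n∉𝒩(𝒬)}`).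

The companion `Section15U056Rate` turns this into u056 with the rate the inputs support (`O(1/𝓛)`,
from u050; the printed `O(1/𝓛³)` is not derived) and the step to (15.23)/(15.24).
WHAT THIS IS NOT: a proof of Lemmas 15.2–15.3, u050 or u055 (typed CLAIM nodes), nor any claim about
Theorems 1–2 of the manuscript or Landau–Siegel zeros.

## References
* Y. Zhang, arXiv:2211.02515v1 (2022), §15 pp. 87–88; §2 (2.31). [cite: Zhang2022LandauSiegel, §15 p.88]
-/

noncomputable section

open Complex Real ComplexConjugate Filter
open Literature.NumberTheory.LFunctions.Zhang2022.Skeleton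
open Literature.NumberTheory.LFunctions.Zhang2022.Typed

namespace Literature.NumberTheory.LFunctions.Zhang2022.Ded1524

/-! ## 1. The Euler-product merge `eulerM1 · eulerU1 = ∏_{(q,D)=1}(1 − q⁻²)` -/

section EulerMerge

variable {D : ℕ} (χ : DirichletCharacter ℂ D)

/-- `|χ(n)| ≤ 1`. [folklore] -/
private theorem norm_chi_le (n : ℕ) : ‖χ (n : ZMod D)‖ ≤ 1 := DirichletCharacter.norm_le_one χ _

/-- `Σ_p 8/p²` converges over the primes. [folklore] -/
private theorem summable_eight_div_sq : Summable fun p : Nat.Primes => 8 / ((p : ℕ) : ℝ) ^ 2 := by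
  have h := (Nat.Primes.summable_rpow (r := -2)).mpr (by norm_num)
  refine (h.mul_left 8).congr fun p => ?_
  rw [Real.rpow_neg (Nat.cast_nonneg _), show (2 : ℝ) = ((2 : ℕ) : ℝ) by norm_num,
    Real.rpow_natCast, div_eq_mul_inv]

/-- `((1 − c/x)/(1 − 1/x)) − 1 = (1 − c)/(x − 1)` for `x ≠ 0, 1`. [folklore] -/
private theorem factorM_sub_one (x c : ℂ) (hx : x ≠ 0) (hx1 : x - 1 ≠ 0) :
    (1 - c / x) / (1 - 1 / x) - 1 = (1 - c) / (x - 1) := by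
  field_simp
  ring

/-- `((1 − 1/x)²/(1 − c/x)) − 1 = ((c − 2)x + 1)/(x(x − c))` for `x ≠ 0`, `x ≠ c`. [folklore] -/
private theorem factorU_sub_one (x c : ℂ) (hx : x ≠ 0) (hxc : x - c ≠ 0) :
    (1 - 1 / x) ^ 2 / (1 - c / x) - 1 = ((c - 2) * x + 1) / (x * (x - c)) := by
  field_simp
  ring

/-- For a prime `p`: `x = p²` (as a complex number) has `‖x‖ = p² ≥ 4`, so `x ≠ 0`, `‖x − 1‖ ≥ p²/2`,
`‖x − c‖ ≥ p²/2` for `‖c‖ ≤ 1`. [folklore] -/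
private theorem sq_facts (p : Nat.Primes) (c : ℂ) (hc : ‖c‖ ≤ 1) :
    (((p : ℕ) : ℂ) ^ 2 ≠ 0) ∧ ((p : ℕ) : ℝ) ^ 2 / 2 ≤ ‖((p : ℕ) : ℂ) ^ 2 - 1‖ ∧
      ((p : ℕ) : ℝ) ^ 2 / 2 ≤ ‖((p : ℕ) : ℂ) ^ 2 - c‖ ∧ (4 : ℝ) ≤ ((p : ℕ) : ℝ) ^ 2 := by
  have hp2 : (2 : ℝ) ≤ (p : ℕ) := by exact_mod_cast p.prop.two_le
  have h4 : (4 : ℝ) ≤ ((p : ℕ) : ℝ) ^ 2 := by nlinarith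
  have hn : ‖((p : ℕ) : ℂ) ^ 2‖ = ((p : ℕ) : ℝ) ^ 2 := by rw [norm_pow, Complex.norm_natCast]
  refine ⟨?_, ?_, ?_, h4⟩
  · intro h; rw [h, norm_zero] at hn; linarith
  · have := norm_sub_norm_le (((p : ℕ) : ℂ) ^ 2) 1
    rw [hn, norm_one] at this; linarith
  · have := norm_sub_norm_le (((p : ℕ) : ℂ) ^ 2) c
    rw [hn] at this; linarith

/-- The `𝓜₁` Euler factor differs from `1` by `≤ 8/p²`. [cite: Zhang2022LandauSiegel, §15 Lemma 15.2 p.87] -/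
private theorem norm_factorM_sub_one_le (p : Nat.Primes) :
    ‖(if Nat.Coprime (p : ℕ) D then
        (1 - χ ((p : ℕ) : ZMod D) / ((p : ℕ) : ℂ) ^ 2) / (1 - 1 / ((p : ℕ) : ℂ) ^ 2) else 1) - 1‖ ≤
      8 / ((p : ℕ) : ℝ) ^ 2 := by
  obtain ⟨hx, hx1, -, h4⟩ := sq_facts p (χ ((p : ℕ) : ZMod D)) (norm_chi_le χ _)
  split_ifs with hcop
  · have hx1' : ((p : ℕ) : ℂ) ^ 2 - 1 ≠ 0 := by
      intro h; rw [h, norm_zero] at hx1; linarith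
    rw [factorM_sub_one _ _ hx hx1', norm_div]
    have hnum : ‖1 - χ ((p : ℕ) : ZMod D)‖ ≤ 2 := by
      calc ‖1 - χ ((p : ℕ) : ZMod D)‖ ≤ ‖(1 : ℂ)‖ + ‖χ ((p : ℕ) : ZMod D)‖ := norm_sub_le _ _
        _ ≤ 1 + 1 := by rw [norm_one]; exact add_le_add le_rfl (norm_chi_le χ _)
        _ = 2 := by norm_num
    rw [div_le_div_iff₀ (by linarith) (by positivity)]
    nlinarith [norm_nonneg (1 - χ ((p : ℕ) : ZMod D))]
  · simp only [sub_self, norm_zero]; positivity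

/-- The `𝒰` Euler factor differs from `1` by `≤ 8/p²`. [cite: Zhang2022LandauSiegel, §15 Lemma 15.3 p.87] -/
private theorem norm_factorU_sub_one_le (p : Nat.Primes) :
    ‖(if Nat.Coprime (p : ℕ) D then
        (1 - 1 / ((p : ℕ) : ℂ) ^ 2) ^ 2 / (1 - χ ((p : ℕ) : ZMod D) / ((p : ℕ) : ℂ) ^ 2) else 1) - 1‖ ≤
      8 / ((p : ℕ) : ℝ) ^ 2 := by
  obtain ⟨hx, -, hxc, h4⟩ := sq_facts p (χ ((p : ℕ) : ZMod D)) (norm_chi_le χ _)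
  split_ifs with hcop
  · have hxc' : ((p : ℕ) : ℂ) ^ 2 - χ ((p : ℕ) : ZMod D) ≠ 0 := by
      intro h; rw [h, norm_zero] at hxc; linarith
    rw [factorU_sub_one _ _ hx hxc', norm_div, norm_mul]
    have hn : ‖((p : ℕ) : ℂ) ^ 2‖ = ((p : ℕ) : ℝ) ^ 2 := by rw [norm_pow, Complex.norm_natCast]
    have hnum : ‖(χ ((p : ℕ) : ZMod D) - 2) * ((p : ℕ) : ℂ) ^ 2 + 1‖ ≤ 3 * ((p : ℕ) : ℝ) ^ 2 + 1 := by
      calc ‖(χ ((p : ℕ) : ZMod D) - 2) * ((p : ℕ) : ℂ) ^ 2 + 1‖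
          ≤ ‖(χ ((p : ℕ) : ZMod D) - 2) * ((p : ℕ) : ℂ) ^ 2‖ + ‖(1 : ℂ)‖ := norm_add_le _ _
        _ = ‖χ ((p : ℕ) : ZMod D) - 2‖ * ((p : ℕ) : ℝ) ^ 2 + 1 := by rw [norm_mul, hn, norm_one]
        _ ≤ 3 * ((p : ℕ) : ℝ) ^ 2 + 1 := by
            gcongr
            calc ‖χ ((p : ℕ) : ZMod D) - 2‖ ≤ ‖χ ((p : ℕ) : ZMod D)‖ + ‖(2 : ℂ)‖ := norm_sub_le _ _
              _ ≤ 1 + 2 := by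
                  refine add_le_add (norm_chi_le χ _) ?_
                  simp
              _ = 3 := by norm_num
    rw [hn, div_le_div_iff₀ (by nlinarith) (by positivity)]
    nlinarith [norm_nonneg ((χ ((p : ℕ) : ZMod D) - 2) * ((p : ℕ) : ℂ) ^ 2 + 1)]
  · simp only [sub_self, norm_zero]; positivity

/-- Both coprime-restricted Euler products `eulerM1`, `eulerU1` CONVERGE (are `Multipliable`): their
factors are `1 + O(p⁻²)` (`Complex.multipliable_one_add_of_summable`). [cite: Zhang2022LandauSiegel, §15 p.87] -/
theorem multipliable_eulerM1_eulerU1 :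
    Multipliable (fun p : Nat.Primes => if Nat.Coprime (p : ℕ) D then
        (1 - χ ((p : ℕ) : ZMod D) / ((p : ℕ) : ℂ) ^ 2) / (1 - 1 / ((p : ℕ) : ℂ) ^ 2) else 1) ∧
      Multipliable (fun p : Nat.Primes => if Nat.Coprime (p : ℕ) D then
        (1 - 1 / ((p : ℕ) : ℂ) ^ 2) ^ 2 / (1 - χ ((p : ℕ) : ZMod D) / ((p : ℕ) : ℂ) ^ 2) else 1) := by
  have hs := summable_eight_div_sq
  constructor
  · set F : Nat.Primes → ℂ := fun p => if Nat.Coprime (p : ℕ) D then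
        (1 - χ ((p : ℕ) : ZMod D) / ((p : ℕ) : ℂ) ^ 2) / (1 - 1 / ((p : ℕ) : ℂ) ^ 2) else 1 with hF
    have hsum : Summable fun p : Nat.Primes => F p - 1 :=
      Summable.of_norm_bounded hs fun p => norm_factorM_sub_one_le χ p
    have h := Complex.multipliable_one_add_of_summable hsum
    refine h.congr fun p => ?_
    ring
  · set F : Nat.Primes → ℂ := fun p => if Nat.Coprime (p : ℕ) D then
        (1 - 1 / ((p : ℕ) : ℂ) ^ 2) ^ 2 / (1 - χ ((p : ℕ) : ZMod D) / ((p : ℕ) : ℂ) ^ 2) else 1 with hF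
    have hsum : Summable fun p : Nat.Primes => F p - 1 :=
      Summable.of_norm_bounded hs fun p => norm_factorU_sub_one_le χ p
    have h := Complex.multipliable_one_add_of_summable hsum
    refine h.congr fun p => ?_
    ring

/-- **The merge of the two Euler products**: `eulerM1 · eulerU1 = ∏_{(q,D)=1}(1 − q⁻²)` (complex form;
the factors multiply to `(1 − q⁻²)` at each prime coprime to `D` and to `1` otherwise), i.e. the
product "`𝓜₁(1,1;·)𝒰(1)`" of Lemmas 15.2–15.3 that §15 p.88 evaluates with u057.
[cite: Zhang2022LandauSiegel, §15 p.88] -/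
theorem eulerM1_mul_eulerU1 [NeZero D] :
    Section15C.eulerM1 χ * Section15C.eulerU1 χ =
      ∏' p : Nat.Primes, (if Nat.Coprime (p : ℕ) D then (1 - 1 / ((p : ℕ) : ℂ) ^ 2) else 1) := by
  obtain ⟨hM, hU⟩ := multipliable_eulerM1_eulerU1 χ
  rw [Section15C.eulerM1, Section15C.eulerU1, ← hM.tprod_mul hU]
  refine tprod_congr fun p => ?_
  obtain ⟨hx, hx1, hxc, h4⟩ := sq_facts p (χ ((p : ℕ) : ZMod D)) (norm_chi_le χ _)
  split_ifs with hcop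
  · have hx1' : ((p : ℕ) : ℂ) ^ 2 - 1 ≠ 0 := by
      intro h; rw [h, norm_zero] at hx1; linarith
    have hxc' : ((p : ℕ) : ℂ) ^ 2 - χ ((p : ℕ) : ZMod D) ≠ 0 := by
      intro h; rw [h, norm_zero] at hxc; linarith
    have hden1 : (1 : ℂ) - 1 / ((p : ℕ) : ℂ) ^ 2 ≠ 0 := by
      rw [one_sub_div hx]; exact div_ne_zero hx1' hx
    have hden2 : (1 : ℂ) - χ ((p : ℕ) : ZMod D) / ((p : ℕ) : ℂ) ^ 2 ≠ 0 := by
      rw [one_sub_div hx]; exact div_ne_zero hxc' hx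
    field_simp
  · simp

/-- The same merge with the real Euler identity of u057 inserted:
`eulerM1 · eulerU1 = (6/π²)∏_{q∣D}(1 − q⁻²)⁻¹` (as a complex number), by L4-t3's
`Typed.Section15C.tprod_coprime_one_sub_inv_sq`. [cite: Zhang2022LandauSiegel, §15 p.88] -/
theorem eulerM1_mul_eulerU1_eq [NeZero D] :
    Section15C.eulerM1 χ * Section15C.eulerU1 χ =
      ((6 / π ^ 2 * ∏ q ∈ D.primeFactors, (1 - 1 / (q : ℝ) ^ 2)⁻¹ : ℝ) : ℂ) := by
  have hD : 0 < D := Nat.pos_of_ne_zero (NeZero.ne D)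
  rw [eulerM1_mul_eulerU1, ← Section15C.tprod_coprime_one_sub_inv_sq hD]
  -- the complex coprime-restricted product is the cast of the real one
  have hreal : Multipliable (fun p : Nat.Primes =>
      if Nat.Coprime (p : ℕ) D then (1 - 1 / ((p : ℕ) : ℝ) ^ 2) else 1) := by
    have hs : Summable fun p : Nat.Primes => 1 / ((p : ℕ) : ℝ) ^ 2 :=
      (summable_eight_div_sq.mul_left (1 / 8)).congr fun p => by ring
    have hsum : Summable fun p : Nat.Primes =>
        (if Nat.Coprime (p : ℕ) D then (1 - 1 / ((p : ℕ) : ℝ) ^ 2) else 1) - 1 := by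
      refine Summable.of_norm_bounded hs fun p => ?_
      split_ifs
      · rw [sub_sub_cancel_left, norm_neg, Real.norm_of_nonneg (by positivity)]
      · simp only [sub_self, norm_zero]; positivity
    exact (Real.multipliable_one_add_of_summable hsum).congr fun p => by ring
  have h2 : (((∏' p : Nat.Primes, (if Nat.Coprime (p : ℕ) D then (1 - 1 / ((p : ℕ) : ℝ) ^ 2) else 1)
      : ℝ)) : ℂ) = ∏' p : Nat.Primes,
        (((if Nat.Coprime (p : ℕ) D then (1 - 1 / ((p : ℕ) : ℝ) ^ 2) else 1 : ℝ)) : ℂ) := by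
    simpa [Function.comp_def] using
      (hreal.hasProd.map Complex.ofRealHom Complex.continuous_ofReal).tprod_eq.symm
  rw [h2]
  refine tprod_congr fun p => ?_
  split_ifs <;> push_cast <;> rfl


/-! ## 2. The main term: `L′(1,χ)²·(φ(D)/D)²·(eulerM1·eulerU1) = 𝔞·φ(D)/D` (u057 inserted) -/

/-- **The main term of u056 is exact**: for `χ` quadratic primitive mod `D ≥ 3`,
`L′(1,χ)²·(φ(D)²/D²)·(eulerM1·eulerU1) = 𝔞·φ(D)/D` — by the merge `eulerM1·eulerU1 =
(6/π²)∏_{q∣D}(1−q⁻²)⁻¹`, the Euler identity u057 (`(φ(D)/D)·(6/π²)∏_{q∣D}(1−q⁻²)⁻¹ = (6/π²)∏_{q∣D}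
q/(q+1)`, L4-t3's `step15_u057_holds` + `tprod_coprime_one_sub_inv_sq`), `𝔞 = (6/π²)L′(1,χ)²∏_{q∣D}
q/(q+1)` (2.31) and `L′(1,χ) ∈ ℝ` (tree `Lemma171.frakAC_eq`). [cite: Zhang2022LandauSiegel, §15 p.88] -/
theorem mainTerm_u056 [NeZero D] (hp : χ.IsPrimitive) (hq : χ.IsQuadratic) (hD : 3 ≤ D) :
    deriv χ.LFunction 1 ^ 2 * ((Nat.totient D : ℂ) ^ 2 / (D : ℂ) ^ 2) *
        (Section15C.eulerM1 χ * Section15C.eulerU1 χ) =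
      (frakA χ : ℂ) * (Nat.totient D : ℂ) / (D : ℂ) := by
  have hD0 : 0 < D := by omega
  have hne : χ ≠ 1 := ne_one_of_isPrimitive_of_three_le hp hD
  have h57 := Section15C.step15_u057_holds D hD0
  rw [Section15C.tprod_coprime_one_sub_inv_sq hD0] at h57
  rw [eulerM1_mul_eulerU1_eq, frakA, ← Lemma171.frakAC_eq χ hne hq.sq_eq_one, Lemma171.frakAC]
  push_cast
  have h57c : (Nat.totient D : ℂ) / (D : ℂ) *
      (6 / (π : ℂ) ^ 2 * ∏ x ∈ D.primeFactors, (1 - 1 / (x : ℂ) ^ 2)⁻¹) =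
        6 / (π : ℂ) ^ 2 * ∏ x ∈ D.primeFactors, ((x : ℂ) / (x + 1)) := by
    have := congrArg (fun r : ℝ => (r : ℂ)) h57
    push_cast at this
    exact this
  linear_combination (deriv χ.LFunction 1 ^ 2 * ((Nat.totient D : ℂ) / (D : ℂ))) * h57c

end EulerMerge

/-! ## 3. The bookkeeping of "This together with Lemma 15.2 and 15.3 yields", pointwise -/

/-- **Pointwise form of the u056 step.** With `M = 𝓜₁(1,1;1−βⱼ)`, `e_M` = Lemma 15.2's Euler product,
`U₁ = 𝒰(1)`, `e_U` = Lemma 15.3's Euler product, `P = φ(D)²/D²`, `S_T = Σ_{n<T}`, `S_N = Σ_{n∉𝒩(𝒬)}`,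
`L = L′(1,χ)`: if `‖M − e_M‖ ≤ ε₁`, `‖U₁ − Pe_U‖ ≤ ε₃`, `‖S_T − L²U₁‖ ≤ ε₄`, `‖S_N‖ ≤ ε₅`, `‖M‖ ≤ C₆`,
`‖U₁‖ ≤ C₂`, `‖L‖ ≤ L_b` and `L²P(e_Me_U) = A` (the exact main term), then
`‖M(S_T − S_N) − A‖ ≤ C₆ε₅ + C₆ε₄ + L_b²(C₆ε₃ + ε₁(C₂ + ε₃))`. [cite: Zhang2022LandauSiegel, §15 p.88] -/
theorem u056_pointwise {M eM U₁ eU P ST SN L A : ℂ} {ε₁ ε₃ ε₄ ε₅ C₂ C₆ Lb : ℝ}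
    (h1 : ‖M - eM‖ ≤ ε₁) (h3 : ‖U₁ - P * eU‖ ≤ ε₃) (h4 : ‖ST - L ^ 2 * U₁‖ ≤ ε₄) (h5 : ‖SN‖ ≤ ε₅)
    (hM : ‖M‖ ≤ C₆) (hU : ‖U₁‖ ≤ C₂) (hL : ‖L‖ ≤ Lb) (hA : L ^ 2 * P * (eM * eU) = A) :
    ‖M * (ST - SN) - A‖ ≤ C₆ * ε₅ + C₆ * ε₄ + Lb ^ 2 * (C₆ * ε₃ + ε₁ * (C₂ + ε₃)) := by
  have hC₆ : 0 ≤ C₆ := (norm_nonneg _).trans hM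
  have hε₁ : 0 ≤ ε₁ := (norm_nonneg _).trans h1
  have hε₃ : 0 ≤ ε₃ := (norm_nonneg _).trans h3
  have key : M * (ST - SN) - A =
      -(M * SN) + M * (ST - L ^ 2 * U₁) + L ^ 2 * (M * (U₁ - P * eU) + (M - eM) * (P * eU)) := by
    rw [← hA]; ring
  have hPeU : ‖P * eU‖ ≤ C₂ + ε₃ := by
    calc ‖P * eU‖ = ‖U₁ - (U₁ - P * eU)‖ := by ring_nf
      _ ≤ ‖U₁‖ + ‖U₁ - P * eU‖ := norm_sub_le _ _
      _ ≤ C₂ + ε₃ := add_le_add hU h3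
  rw [key]
  calc ‖-(M * SN) + M * (ST - L ^ 2 * U₁) + L ^ 2 * (M * (U₁ - P * eU) + (M - eM) * (P * eU))‖
      ≤ ‖-(M * SN)‖ + ‖M * (ST - L ^ 2 * U₁)‖ +
          ‖L ^ 2 * (M * (U₁ - P * eU) + (M - eM) * (P * eU))‖ :=
        (norm_add_le _ _).trans (by gcongr; exact norm_add_le _ _)
    _ ≤ C₆ * ε₅ + C₆ * ε₄ + Lb ^ 2 * (C₆ * ε₃ + ε₁ * (C₂ + ε₃)) := by
        gcongr
        · rw [norm_neg, norm_mul]; gcongr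
        · rw [norm_mul]; gcongr
        · rw [norm_mul, norm_pow]
          gcongr
          calc ‖M * (U₁ - P * eU) + (M - eM) * (P * eU)‖
              ≤ ‖M * (U₁ - P * eU)‖ + ‖(M - eM) * (P * eU)‖ := norm_add_le _ _
            _ ≤ C₆ * ε₃ + ε₁ * (C₂ + ε₃) := by
                rw [norm_mul, norm_mul]; gcongr

end Literature.NumberTheory.LFunctions.Zhang2022.Ded1524
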